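import Summits.HodgeConjecture.HodgeConjecture.Theorems.Ring2HypothesesDescentKunnethComponentsAbelian
import HarnessLib

/-!
# Ring 2 hypotheses, descent face — THE KÜNNETH COMPONENTS OF THE DIAGONAL OF A COMPLEX ABELIAN VARIETY ARE RATIONAL ALGEBRAIC
# CLASSES; hence Deligne's Example 2.1 (b) («the `πⁱ` are absolute Hodge cycles») FOR ABELIAN VARIETIES follows from his
# Example 2.1 (a) (cycle classes are absolute Hodge) alone

research route conditional on HC_CM; not a corollary; Q11.4-sentence-2 already refuted in dim ≥ 3.
Cell `pub-hodge-ring2` (Hodge ladder STAGE 3), seat `ring2-b05` (binder row b05 `Ring2.Hypotheses.MotivatedImpliesAlgebraicAV`),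
gen 46, fifth file (sequel of `Ring2HypothesesDescentKunnethComponentsAbelian`). `HC_CM` (`Theses.RankFourFaces.CMAbelianHodge`) does
not occur in this file; nothing here proves a case of the Hodge conjecture; no binder of the cell is discharged.

The first gen-46 file proved `C(A)` in class form with COMPLEX Vandermonde coefficients (part XXII-f's
`ϖ_k = Σ_n c_{k,n} [Γ_{[n]}]`, `c ∈ ℂ`), leaving the RATIONALITY of the Künneth components unclaimed. The Vandermonde system
`Σ_n c_n nᵃ = δ_{ak}` has rational nodes, so it is solvable over `ℚ`; the graph classes `[Γ_{[n]}]` are rational (Gysin images of `1`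
for the complex orientations); so `ϖ_k` is a RATIONAL class, and by the faithfulness of the total action every member of every
Künneth decomposition of `cl(Δ_A)` equals some `ϖ_k`. Consequently the hypothesis set of Deligne's Ex. 2.1 (b)
(`deligne1982_kunnethComponents_absoluteHodge`: all Künneth components of the diagonal are absolute Hodge) is, FOR ABELIAN VARIETIES,
a consequence of Ex. 2.1 (a) (`deligne1982_cycleClass_absoluteHodge`: rational algebraic classes are absolute Hodge).

* §1 `exists_vandermonde_solution_rat` (the interpolation over `ℚ`), `exists_rational_kunnethProjector_abelianVariety` (XXII-f's
  projector with rational coefficients: rational, algebraic, action `δ_{ak}`).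
* §2 **`isRationalClass_kunnethComponent_diagonal`** (every member of every Künneth decomposition of `cl(Δ_A)` is a rational class),
  **`isAbsoluteHodgeClass_kunnethComponent_diagonal_of_cycleClass`** and
  **`deligne1982_kunnethComponents_absoluteHodge_abelianVariety`** — Ex. 2.1 (b) for complex abelian varieties from Ex. 2.1 (a).

HONEST COLUMN. No definition, no named fact, no sorry; Ex. 2.1 (a) is a displayed HYPOTHESIS (the tree's named fact, not
discharged); Ex. 2.1 (b) is NOT discharged in general (non-abelian `X`). Count once theirs: `exists_kunnethProjector_abelianVariety`,
`corrAction_graph_nsmul` (ab-andre-2 XXII-f). References: Kleiman1968AlgebraicCycles (§2, App. 2A); Deligne1982HodgeCycles (§2 Ex. 2.1 (a),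
(b) p. 15); MumfordAV1970 (§19); VoisinHodgeI2002 (§7.3.2, §11.1.2).
-/

noncomputable section

-- every declaration of this problem lives in `Summit.HodgeConjecture.HodgeConjecture.…` (summit = sub-problem)
set_option linter.dupNamespace false

open CategoryTheory AlgebraicGeometry MonoidalCategory CartesianMonoidalCategory
open Literature.AlgebraicTopology.SingularHomology
open Literature.AlgebraicGeometry Literature.AlgebraicGeometry.Motives Literature.AlgebraicGeometry.HodgeTheory
open Summit.HodgeConjecture.HodgeConjecture.Ring2.AbelianAll (corrAction_graph_nsmul)

namespace Summit.HodgeConjecture.HodgeConjecture.Theorems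

/-! ## §1 The rational Künneth projectors -/

/-- **Interpolation of `δ_{·k}` on the nodes `0, …, N` by powers, over `ℚ`**: there are `c₀, …, c_N ∈ ℚ` with
`Σ_{n ≤ N} c_n nᵃ = δ_{ak}` for all `a ≤ N` (the Vandermonde matrix of the distinct rational nodes `0, …, N` is invertible; part XXII-f's
`exists_vandermonde_solution` over `ℂ`, verbatim over `ℚ`). [folklore] -/
theorem exists_vandermonde_solution_rat (N k : ℕ) :
    ∃ c : Fin (N + 1) → ℚ, ∀ a : ℕ, a ≤ N →
      ∑ i : Fin (N + 1), c i * ((i : ℕ) : ℚ) ^ a = if a = k then 1 else 0 := by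
  classical
  by_cases hk : k ≤ N
  · set v : Fin (N + 1) → ℚ := fun i ↦ ((i : ℕ) : ℚ) with hv
    set V : Matrix (Fin (N + 1)) (Fin (N + 1)) ℚ := (Matrix.vandermonde v).transpose with hV
    have hdet : IsUnit V.det := by
      rw [hV, Matrix.det_transpose, isUnit_iff_ne_zero, Matrix.det_vandermonde_ne_zero_iff]
      intro i j hij
      have h' : ((i : ℕ) : ℚ) = ((j : ℕ) : ℚ) := hij
      exact Fin.ext (Nat.cast_injective h')
    set e : Fin (N + 1) → ℚ := Pi.single (⟨k, by omega⟩ : Fin (N + 1)) 1 with he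
    refine ⟨V⁻¹.mulVec e, fun a ha ↦ ?_⟩
    have hsol : V.mulVec (V⁻¹.mulVec e) = e := by
      rw [Matrix.mulVec_mulVec, Matrix.mul_nonsing_inv _ hdet, Matrix.one_mulVec]
    have hrow := congrFun hsol ⟨a, by omega⟩
    rw [Matrix.mulVec, dotProduct] at hrow
    calc ∑ i : Fin (N + 1), V⁻¹.mulVec e i * ((i : ℕ) : ℚ) ^ a
        = ∑ i : Fin (N + 1), V ⟨a, by omega⟩ i * V⁻¹.mulVec e i := by
          refine Finset.sum_congr rfl fun i _ ↦ ?_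
          rw [hV, Matrix.transpose_apply, Matrix.vandermonde_apply, mul_comm]
      _ = e ⟨a, by omega⟩ := hrow
      _ = if a = k then 1 else 0 := by
          rw [he, Pi.single_apply]
          simp only [Fin.mk.injEq]
  · refine ⟨0, fun a ha ↦ ?_⟩
    have hak : a ≠ k := by omega
    simp [hak]

/-- **Part XXII-f's Künneth projector with RATIONAL coefficients**: for a complex abelian variety `A` of dimension `g` and every `k`
there is a class `ϖ ∈ H^{2g}((A ⊗ A)(ℂ); ℂ)` which is a RATIONAL class, an algebraic class, and acts on `Hᵃ(A(ℂ); ℂ)` as `δ_{ak} · 1`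
for every `a ≤ 2g` — `ϖ = Σ_{n ≤ 2g} c_n [Γ_{[n]}]` with `c ∈ ℚ^{2g+1}` the rational Vandermonde solution, `[Γ_{[n]}]` the (rational,
algebraic) graph classes of multiplication by `n`, acting as `nᵃ` (`corrAction_graph_nsmul`). [cite: Kleiman1968AlgebraicCycles, §2 and Appendix 2A]
[cite: MumfordAV1970, §19] [cite: VoisinHodgeI2002, §7.3.2] -/
theorem exists_rational_kunnethProjector_abelianVariety (A : AbelianVariety ℂ) (k : ℕ) :
    ∃ ϖ : complexBetti (A.X ⊗ A.X) (2 * A.dim), IsRationalClass ϖ ∧ ϖ ∈ algebraicClasses (A.X ⊗ A.X) A.dim ∧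
      ∀ a : ℕ, a ≤ 2 * A.dim →
        corrAction complexOrientationFamily (AbelianVariety.isSmoothProjective_holds (A := A))
          (AbelianVariety.isSmoothProjective_holds (A := A)) (rfl : a + 2 * A.dim = a + 2 * A.dim) ϖ =
        (if a = k then (1 : ℂ) else 0) • LinearMap.id := by
  classical
  have hA : IsSmoothProjective A.dim A.X := AbelianVariety.isSmoothProjective_holds (A := A)
  obtain ⟨c, hc⟩ := exists_vandermonde_solution_rat (2 * A.dim) k
  -- the graph classes of `[n]`, `n = 0, …, 2g`
  set Γ : Fin (2 * A.dim + 1) → complexBetti (A.X ⊗ A.X) (2 * A.dim) := fun i ↦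
    complexGysin complexOrientationFamily hA (hA.tensor_holds hA) (lift (𝟙 A.X) ((i : ℕ) • 𝟙 A).hom.hom.hom)
      (show 0 + 2 * (A.dim + A.dim) = 2 * A.dim + 2 * A.dim by omega) (singularCohomology.one ℂ (ComplexPoints A.X))
    with hΓ
  refine ⟨∑ i, ((c i : ℚ) : ℂ) • Γ i, ?_, Submodule.sum_mem _ fun i _ ↦ Submodule.smul_mem _ _ ?_, fun a ha ↦ ?_⟩
  · -- rationality: a `ℚ`-combination of Gysin images of `1`
    have hΓr : ∀ i, IsRationalClass (Γ i) := fun i ↦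
      isRationalClass_complexGysin_complexOrientationFamily hA (hA.tensor_holds hA) _ _ (isRationalClass_one _)
    have hs : ∀ s : Finset (Fin (2 * A.dim + 1)), IsRationalClass (∑ i ∈ s, ((c i : ℚ) : ℂ) • Γ i) := by
      intro s
      induction s using Finset.induction_on with
      | empty => simpa using (IsRationalClass.zero : IsRationalClass (0 : complexBetti (A.X ⊗ A.X) (2 * A.dim)))
      | insert i s hi ih =>
        rw [Finset.sum_insert hi]
        exact ((hΓr i).smul (c i)).add ih
    exact hs Finset.univ
  · exact complexGysin_graph_one_mem_algebraicClasses complexOrientationFamily hasPoincareDuality_complexOrientationFamily hA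
      (hA.tensor_holds hA) _
  · rw [map_sum]
    simp only [map_smul, hΓ]
    rw [show (∑ i : Fin (2 * A.dim + 1), ((c i : ℚ) : ℂ) • corrAction complexOrientationFamily hA hA
          (rfl : a + 2 * A.dim = a + 2 * A.dim)
        (complexGysin complexOrientationFamily hA (hA.tensor_holds hA) (lift (𝟙 A.X) ((i : ℕ) • 𝟙 A).hom.hom.hom)
          (show 0 + 2 * (A.dim + A.dim) = 2 * A.dim + 2 * A.dim by omega) (singularCohomology.one ℂ (ComplexPoints A.X)))) =
        ∑ i : Fin (2 * A.dim + 1), (((c i : ℚ) : ℂ) * ((i : ℕ) : ℂ) ^ a) •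
          (LinearMap.id : complexBetti A.X a →ₗ[ℂ] complexBetti A.X a)
      from Finset.sum_congr rfl fun i _ ↦ by rw [corrAction_graph_nsmul A i a ha, smul_smul]]
    rw [← Finset.sum_smul]
    congr 1
    have h := hc a ha
    split_ifs at h ⊢ <;> exact_mod_cast h

/-! ## §2 Rationality of the Künneth components; Deligne's Ex. 2.1 (b) for abelian varieties from Ex. 2.1 (a) -/

/-- **Every member of every Künneth decomposition `cl(Δ_A) = Σᵢ πⁱ` of the diagonal of a complex abelian variety is a RATIONAL class**:
`πⁱ` and the rational projector `ϖ_{2g-i}` of §1 have the same action on every `Hᵃ(A(ℂ); ℂ)` (first gen-46 file,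
`corrAction_kunnethComponent_diagonal`), so they are equal (gen 37's `eq_zero_of_forall_corrAction_eq_zero`).
[cite: Kleiman1968AlgebraicCycles, §1.3 and §2] [cite: Deligne1982HodgeCycles, §2 Example 2.1 (b) (p. 15)] -/
theorem isRationalClass_kunnethComponent_diagonal (A : AbelianVariety ℂ)
    {π : Fin (2 * A.dim + 1) → complexBetti (A.X ⊗ A.X) (2 * A.dim)}
    (hπ : ∀ i : Fin (2 * A.dim + 1),
      π i ∈ kunnethPiece A.X A.X (show (2 * A.dim - (i : ℕ)) + i = 2 * A.dim by omega))
    (hΔ : ∑ i, π i = diagonalClass (AbelianVariety.isSmoothProjective_holds (A := A))) (i : Fin (2 * A.dim + 1)) :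
    IsRationalClass (π i) := by
  have hA : IsSmoothProjective A.dim A.X := AbelianVariety.isSmoothProjective_holds (A := A)
  obtain ⟨ϖ, hϖr, -, hact⟩ := exists_rational_kunnethProjector_abelianVariety A (2 * A.dim - (i : ℕ))
  suffices h : π i - ϖ = 0 by
    rw [sub_eq_zero] at h
    rwa [h]
  refine eq_zero_of_forall_corrAction_eq_zero complexOrientationFamily hA fun a ha ↦ ?_
  rw [map_sub, corrAction_kunnethComponent_diagonal hA hπ hΔ i a, hact a ha]
  split_ifs <;> simp

/-- **A Künneth component of `cl(Δ_A)` is an absolute Hodge class, granted Deligne's Ex. 2.1 (a)** (`deligne1982_cycleClass_absoluteHodge`: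
rational algebraic classes are absolute Hodge): it is rational (§2) and algebraic (first gen-46 file). The fact (a) is a HYPOTHESIS.
[cite: Deligne1982HodgeCycles, §2 Example 2.1 (a), (b) (p. 15)] -/
theorem isAbsoluteHodgeClass_kunnethComponent_diagonal_of_cycleClass (hZ : deligne1982_cycleClass_absoluteHodge)
    (A : AbelianVariety ℂ) {π : Fin (2 * A.dim + 1) → complexBetti (A.X ⊗ A.X) (2 * A.dim)}
    (hπ : ∀ i : Fin (2 * A.dim + 1),
      π i ∈ kunnethPiece A.X A.X (show (2 * A.dim - (i : ℕ)) + i = 2 * A.dim by omega))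
    (hΔ : ∑ i, π i = diagonalClass (AbelianVariety.isSmoothProjective_holds (A := A))) (i : Fin (2 * A.dim + 1)) :
    IsAbsoluteHodgeClass (A.dim + A.dim) (A.X ⊗ A.X) A.dim (π i) :=
  hZ ((AbelianVariety.isSmoothProjective_holds (A := A)).tensor_holds (AbelianVariety.isSmoothProjective_holds (A := A))) A.dim
    (π i) (isRationalClass_kunnethComponent_diagonal A hπ hΔ i) (kunnethComponent_diagonal_mem_algebraicClasses A hπ hΔ i)

/-- **DELIGNE 1982, EXAMPLE 2.1 (b) FOR COMPLEX ABELIAN VARIETIES, FROM EXAMPLE 2.1 (a)**: the named fact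
`deligne1982_kunnethComponents_absoluteHodge` («the Künneth components `πⁱ` of `cl(Δ)` are absolute Hodge cycles»), restricted to
`X = A` a complex abelian variety, follows from `deligne1982_cycleClass_absoluteHodge` alone — for EVERY Künneth decomposition of
`cl(Δ_A)`. Neither fact is discharged here; (a) is displayed as a hypothesis. [cite: Deligne1982HodgeCycles, §2 Example 2.1 (a), (b) (p. 15)]
[cite: Kleiman1968AlgebraicCycles, §2 and Appendix 2A] -/
theorem deligne1982_kunnethComponents_absoluteHodge_abelianVariety (hZ : deligne1982_cycleClass_absoluteHodge)
    (A : AbelianVariety ℂ) (π : Fin (2 * A.dim + 1) → complexBetti (A.X ⊗ A.X) (2 * A.dim))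
    (hπ : ∀ i : Fin (2 * A.dim + 1),
      π i ∈ kunnethPiece A.X A.X (show (2 * A.dim - (i : ℕ)) + i = 2 * A.dim by omega))
    (hΔ : ∑ i, π i = diagonalClass (AbelianVariety.isSmoothProjective_holds (A := A))) (i : Fin (2 * A.dim + 1)) :
    IsAbsoluteHodgeClass (A.dim + A.dim) (A.X ⊗ A.X) A.dim (π i) :=
  isAbsoluteHodgeClass_kunnethComponent_diagonal_of_cycleClass hZ A hπ hΔ i

end Summit.HodgeConjecture.HodgeConjecture.Theorems

end
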